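import Literature.AlgebraicGeometry.Morphisms.EtaleQuasiSectionOfFormallySmooth   -- ★ ring form `isSmoothAt_of_artinianLifts` ([EGA IV₄ 17.14.2])
import Mathlib.AlgebraicGeometry.Morphisms.Smooth
import Mathlib.AlgebraicGeometry.Morphisms.FiniteType
import Mathlib.AlgebraicGeometry.Noetherian
import Mathlib.RingTheory.Smooth.Locus
import HarnessLib

/-!
# Smoothness from the lifting of Artinian points — [EGA IV₄] Prop. (17.14.2), SCHEME FORM over a locally Noetherian base

Topic `Literature/AlgebraicGeometry/Morphisms`; namespace `Literature.AlgebraicGeometry.Morphisms`.  THEOREMS ONLY (no definition,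
no named fact, no instance, no notation, no `sorry`).  Cell `hodgecm-mathlib` (D-0151 ∕ D-0183 FLOOR 0), P1 sub-line F-4 layer 2: the
OUTER SHELL of sub-stub (II-c₂) «the law locus is smooth» (B-typ03 (g19) stub menu v3 3ea5fb20, [MumfordFogartyKirwan1994] p. 126
«Proposition 6.15 is precisely the criterion for `ω̄` to be smooth»); generic capital also for F-11.  HC_CM is proved only modulo the 7
printed citations until rung 0 closes; nothing here is about HC.

THE PRINT.  [EGAIV4] Prop. (17.14.2) (p. 98): «Soient `Y` un préschéma localement noethérien, `f : X → Y` un morphisme localement de type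
fini … Pour que `f` soit lisse au point `x`, il faut et il suffit qu'il vérifie la condition de (17.14.1) où l'on suppose de plus que
l'anneau local `A′` est artinien, que `𝔪′𝔍′ = 0` …», (17.14.1) being the lifting of `Y`-morphisms `Spec (A′⧸𝔍′) → X` to `Spec A′ → X`.
The tree holds the RING-LEVEL «il suffit» at the closed points of an affine chart as ★ `Morphisms.isSmoothAt_of_artinianLifts`
([GortzWedhorn2023] Thm. 18.63 (ii)⇒(i)), its `ℂ`-point form ★ `EGAIV4_smoothAt_of_liftsAlongSmallExtensions_holds`, and the special case of a
fine moduli scheme over `ℚ` ★ `SiegelFineModuliScheme.smooth_of_forall_smallExtension_exists_isBaseChangeVia` (F-11).  This file is the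
general SCHEME FORM (sufficiency, the half consumers need):

* `formallySmooth_of_forall_isMaximal_mem_smoothLocus` — «closed points suffice» at the ring level: a finitely presented `R`-algebra
  whose MAXIMAL ideals all lie in the smooth locus is formally smooth (the smooth locus is open, Mathlib `Algebra.isOpen_smoothLocus`, hence
  stable under generalisation, and every prime generalises a maximal ideal; `Algebra.smoothLocus_eq_univ_iff`) — split out for reuse (F-11 ∕ F-13);
* **`smooth_of_artinianLifts`** — `ω : Z → S` locally of finite type, `S` locally Noetherian; if for every Artinian local ring `A`, every
  PROPER ideal `J` with `𝔪_A · J = 0`, every `a : Spec A → S` and every `z₀ : Spec (A⧸J) → Z` with `z₀ ≫ ω = (Spec (A⧸J) → Spec A) ≫ a`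
  there is `z : Spec A → Z` with `z ≫ ω = a` restricting to `z₀`, then `ω` is SMOOTH.

Proof (Mathlib road): `Smooth` is checked on affine charts `Spec C = V ⊆ ω⁻¹(U)`, `U = Spec R` (Mathlib's definition of `Smooth`); `R` is
Noetherian and `C` of finite type, hence of finite presentation, so `RingHom.Smooth` = `Algebra.FormallySmooth` = «the smooth locus of
`C∕R` is everything» (Mathlib `Algebra.smoothLocus_eq_univ_iff`); the smooth locus is OPEN (`Algebra.isOpen_smoothLocus`) hence stable
under generalisation, and every prime generalises a maximal ideal, so it suffices to treat MAXIMAL ideals `q` — where ★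
`isSmoothAt_of_artinianLifts` applies: a test map `g₀ : C → A⧸J` over `R` is a point `z₀ : Spec (A⧸J) → V ⊆ Z` over `a : Spec A → U ⊆ S`
(`IsAffineOpen.fromSpec`, naturality `SpecMap_appLE_fromSpec`), the hypothesis lifts it to `z : Spec A → Z`, `z` lands in `V` (`Spec A` is
one point, hit by `Spec (A⧸J)`), and the corresponding ring map `C → A` is the wanted `R`-algebra lift (`R`-compatibility by cancelling the
open immersion `U ↪ S` and `Spec.map_injective`).

## References
* [EGAIV4] A. Grothendieck, J. Dieudonné, *Éléments de géométrie algébrique* IV₄, Publ. Math. IHÉS 32 (1967), Prop. (17.14.1)–(17.14.2)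
  (p. 98), Déf. (17.3.7) (p. 62).
* [GortzWedhorn2023] U. Görtz, T. Wedhorn, *Algebraic Geometry II* (2023), Thm. 18.63.
-/

noncomputable section

universe u

open CategoryTheory CategoryTheory.Limits AlgebraicGeometry IsLocalRing TopologicalSpace

namespace Literature.AlgebraicGeometry.Morphisms

/-- **«Closed points suffice» for formal smoothness of a finitely presented algebra**: if every MAXIMAL ideal of `A` lies in the smooth
locus of `A ∕ R`, then `A` is formally smooth over `R` — the smooth locus is open ([EGAIV4] Cor. (17.15.13)-type openness; Mathlib
`Algebra.isOpen_smoothLocus`), hence stable under generalisation, and every prime ideal is contained in a maximal one; conclude by Mathlib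
`Algebra.smoothLocus_eq_univ_iff`. [cite: EGAIV4, Prop. (17.14.2), p. 98] [cite: GortzWedhorn2023, Thm. 18.63] -/
theorem formallySmooth_of_forall_isMaximal_mem_smoothLocus {R A : Type*} [CommRing R] [CommRing A] [Algebra R A]
    [Algebra.FinitePresentation R A]
    (h : ∀ q : PrimeSpectrum A, q.asIdeal.IsMaximal → q ∈ Algebra.smoothLocus R A) : Algebra.FormallySmooth R A := by
  rw [← Algebra.smoothLocus_eq_univ_iff]
  refine Set.eq_univ_of_forall fun q => ?_
  obtain ⟨m, hm, hqm⟩ := Ideal.exists_le_maximal q.asIdeal q.2.ne_top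
  have hspec : q ⤳ (⟨m, hm.isPrime⟩ : PrimeSpectrum A) := (PrimeSpectrum.le_iff_specializes _ _).mp hqm
  exact hspec.mem_open Algebra.isOpen_smoothLocus (h ⟨m, hm.isPrime⟩ hm)

set_option backward.isDefEq.respectTransparency false in
/-- **[EGA IV₄] Prop. (17.14.2), scheme form (sufficiency): smoothness from the lifting of Artinian points.**  Let `ω : Z → S` be
locally of finite type with `S` locally Noetherian.  Suppose that for every Artinian local ring `A`, every ideal `J ≠ ⊤` with `𝔪_A · J = 0`,
every `a : Spec A → S` and every `z₀ : Spec (A⧸J) → Z` with `z₀ ≫ ω = Spec (A⧸J) → Spec A ≫ a`, there is `z : Spec A → Z` with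
`z ≫ ω = a` and `Spec (A⧸J) → Spec A ≫ z = z₀`.  Then `ω` is smooth.  (Charts + ★ `isSmoothAt_of_artinianLifts` at the maximal ideals
+ openness of the smooth locus; see the module docstring.) [cite: EGAIV4, Prop. (17.14.2), p. 98] [cite: GortzWedhorn2023, Thm. 18.63 (ii)⇒(i)] -/
theorem smooth_of_artinianLifts {Z S : Scheme.{u}} (ω : Z ⟶ S) [LocallyOfFiniteType ω] [IsLocallyNoetherian S]
    (H : ∀ (A : Type u) [CommRing A] [IsArtinianRing A] [IsLocalRing A] (J : Ideal A), J ≠ ⊤ →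
      maximalIdeal A * J = ⊥ →
      ∀ (a : Spec (.of A) ⟶ S) (z₀ : Spec (.of (A ⧸ J)) ⟶ Z),
        z₀ ≫ ω = Spec.map (CommRingCat.ofHom (Ideal.Quotient.mk J)) ≫ a →
        ∃ z : Spec (.of A) ⟶ Z, z ≫ ω = a ∧ Spec.map (CommRingCat.ofHom (Ideal.Quotient.mk J)) ≫ z = z₀) :
    Smooth ω := by
  classical
  refine ⟨fun {U} hU {V} hV hVU => ?_⟩
  -- the chart `Spec C = V ⊆ ω⁻¹(U)`, `U = Spec R`: `R` Noetherian, `C` of finite type, hence of finite presentation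
  haveI : IsNoetherianRing Γ(S, U) := IsLocallyNoetherian.component_noetherian ⟨U, hU⟩
  have hft : (ω.appLE U V hVU).hom.FiniteType := ω.finiteType_appLE hU hV hVU
  algebraize [(ω.appLE U V hVU).hom]
  haveI : Algebra.FinitePresentation Γ(S, U) Γ(Z, V) := (Algebra.FinitePresentation.of_finiteType).mp inferInstance
  suffices hfs : Algebra.FormallySmooth Γ(S, U) Γ(Z, V) from ⟨hfs, inferInstance⟩
  -- closed points of the chart suffice
  refine formallySmooth_of_forall_isMaximal_mem_smoothLocus fun q hq => ?_
  change Algebra.IsSmoothAt Γ(S, U) q.asIdeal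
  -- the ring criterion at the maximal ideal `q` (`π : C ↠ C ⧸ q`)
  letI := Ideal.Quotient.field q.asIdeal
  refine isSmoothAt_of_artinianLifts (Ideal.Quotient.mkₐ Γ(S, U) q.asIdeal) (Ideal.Quotient.mkₐ_surjective Γ(S, U) _)
    q.asIdeal (Ideal.Quotient.mkₐ_ker Γ(S, U) _) ?_
  intro A _ _ _ _ J hJ g₀ ε hε
  haveI : Nontrivial (A ⧸ J) := ε.toRingHom.domain_nontrivial
  have hJtop : J ≠ ⊤ := fun h => not_subsingleton (A ⧸ J) (Ideal.Quotient.subsingleton_iff.mpr h)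
  -- the test diagram: `a : Spec A → U ⊆ S`, `z₀ : Spec (A⧸J) → V ⊆ Z`
  let i : Spec (CommRingCat.of (A ⧸ J)) ⟶ Spec (CommRingCat.of A) := Spec.map (CommRingCat.ofHom (Ideal.Quotient.mk J))
  let a : Spec (CommRingCat.of A) ⟶ S := Spec.map (CommRingCat.ofHom (algebraMap Γ(S, U) A)) ≫ hU.fromSpec
  let z₀ : Spec (CommRingCat.of (A ⧸ J)) ⟶ Z := Spec.map (CommRingCat.ofHom g₀.toRingHom) ≫ hV.fromSpec
  have hring : ω.appLE U V hVU ≫ CommRingCat.ofHom g₀.toRingHom =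
      CommRingCat.ofHom (algebraMap Γ(S, U) A) ≫ CommRingCat.ofHom (Ideal.Quotient.mk J) := by
    ext r
    change g₀ (algebraMap Γ(S, U) Γ(Z, V) r) = Ideal.Quotient.mk J (algebraMap Γ(S, U) A r)
    rw [g₀.commutes r]
    rfl
  have hcomm : z₀ ≫ ω = i ≫ a := by
    simp only [z₀, a, i, Category.assoc]
    rw [← IsAffineOpen.SpecMap_appLE_fromSpec ω hU hV hVU, ← Spec.map_comp_assoc, ← Spec.map_comp_assoc, hring]
  obtain ⟨z, hz, hz₀⟩ := H A J hJtop hJ a z₀ hcomm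
  -- `z` lands in `V`: `Spec A` is one point, hit by `Spec (A ⧸ J)`, whose image is in `V`
  have hsurj : Function.Surjective i := by
    intro y
    obtain ⟨M, hM⟩ := Ideal.exists_maximal (A ⧸ J)
    refine ⟨(⟨M, hM.isPrime⟩ : PrimeSpectrum (A ⧸ J)), PrimeSpectrum.ext ?_⟩
    rw [IsLocalRing.eq_maximalIdeal (IsArtinianRing.isMaximal_of_isPrime y.asIdeal)]
    exact IsLocalRing.eq_maximalIdeal (IsArtinianRing.isMaximal_of_isPrime _)
  have hpt : ∀ y, z y ∈ V := by
    intro y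
    obtain ⟨w, rfl⟩ := hsurj y
    rw [← Scheme.Hom.comp_apply, hz₀, Scheme.Hom.comp_apply]
    have := Set.mem_range_self (f := fun t => hV.fromSpec t) (Spec.map (CommRingCat.ofHom g₀.toRingHom) w)
    rwa [hV.range_fromSpec] at this
  have hrange : Set.range z ⊆ Set.range (Scheme.Opens.ι V) := by
    rintro _ ⟨y, rfl⟩
    rw [Scheme.Opens.range_ι]
    exact hpt y
  let ℓ := IsOpenImmersion.lift (Scheme.Opens.ι V) z hrange
  have hℓ : ℓ ≫ Scheme.Opens.ι V = z := IsOpenImmersion.lift_fac _ z hrange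
  obtain ⟨gC, hgC⟩ := Spec.map_surjective (ℓ ≫ hV.isoSpec.hom)
  have hgC' : Spec.map gC ≫ hV.fromSpec = z := by
    rw [hgC, Category.assoc, ← IsAffineOpen.isoSpec_inv_ι, Iso.hom_inv_id_assoc, hℓ]
  -- the ring map `gC : C → A` is an `R`-algebra lift of `g₀`
  have hR1 : ω.appLE U V hVU ≫ gC = CommRingCat.ofHom (algebraMap Γ(S, U) A) := by
    have h := hz
    rw [← hgC', Category.assoc, ← IsAffineOpen.SpecMap_appLE_fromSpec ω hU hV hVU, ← Spec.map_comp_assoc] at h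
    change Spec.map (ω.appLE U V hVU ≫ gC) ≫ hU.fromSpec = Spec.map (CommRingCat.ofHom (algebraMap Γ(S, U) A)) ≫ hU.fromSpec at h
    rw [cancel_mono] at h
    exact Spec.map_injective h
  have hR2 : gC ≫ CommRingCat.ofHom (Ideal.Quotient.mk J) = CommRingCat.ofHom g₀.toRingHom := by
    have h := hz₀
    change i ≫ z = z₀ at h
    rw [← hgC', ← Spec.map_comp_assoc, cancel_mono] at h
    exact Spec.map_injective h
  let gA : Γ(Z, V) →ₐ[Γ(S, U)] A := ⟨gC.hom, fun r => congr(($hR1).hom r)⟩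
  refine ⟨gA, AlgHom.ext fun c => ?_⟩
  exact congr(($hR2).hom c)

end Literature.AlgebraicGeometry.Morphisms

end
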